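import Summits.ResolutionOfSingularities.ResolutionOfSingularities.Theorems.MarkedTransferCampaignW46MohWindowShadeCleaning
import HarnessLib

/-!
# [OURS · L1 W4.6] Rung (iii) "Moh window", surfaces — the RUN FORMULA of a phase of point blow-ups in
  one chart, and the formal `p`-fold curve it produces

Cell `res-hironaka`, rung L, slot W4.6, seat `res-L1-s46-pv-6` (gen 3): the engine of the TERMINATION half
for SURFACES (two residual letters `σ = {j, i}`) in the tree's transcription of [Hauser2010, §§F–G]
(`PointBlowup.State/step`, `PointBlowupShade.lean`), for walks presented in the Hauser–Wagner frame
(translated and horizontal moves read in the chart of the rigid letter `y_j`).  Built on the toolkit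
`…MohWindowShadeCleaning.lean`:

* §3 THE RUN FORMULA (`exists_run_formula`): after `k` consecutive steps in the chart `y_j` at the points
  `t₀, …, t_{k−1}` of the `y_i`-axis, `F_k · y_j^{pk} + D = F₀(y_j, y_j^k·y_i + ψ_k(y_j))` with
  `ψ_k = Σ_n t_n y_j^{n+1}` the DIGIT EXPANSION of the points and `D` `p`-th-power-supported — the `k`-fold
  blow-up along the points is the substitution of the digit expansion, modulo `p`-th powers.
* §4 reading the support (`exists_digits_support_bound`): if the `k`-th residual polynomial has all its
  monomials of degree `≥ o`, every monomial `y^e` of `clean(F₀(y_j, y_i + ψ_k))` has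
  `o + pk ≤ e_j + (k+1)·e_i`.
* §5 (`exists_formal_pth_power_of_run`): hence `F₀ ≡ (y_i − ψ_k(y_j))^p · w` modulo monomials of degree
  `≥ o + k` — a long phase in one chart at constant order exhibits `F₀`, to high order, as the `p`-th power
  of a SMOOTH curve times a cofactor: the formal `p`-fold-curve case that the termination theorem excludes
  (inhabited by gen 2's in-window two-cycles and fixed point, `…Cycle` / `…FixedPoint`).
OURS; replaces — for regime (iii) of RESCUE-SEED W4.6, the classical pair, surfaces — the ROLE of the
termination clause of Th. 16.13 (ms. p. 87) by an explicit accounting of the walk; NOT a statement of the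
manuscript [claim: Hironaka2017, status: under-review], nothing of which is used.  AI review is weaker than
expert review.
-/

noncomputable section

set_option linter.dupNamespace false -- mandated namespace of this single-conjunct summit

open MvPolynomial Finset

namespace Summit.ResolutionOfSingularities.ResolutionOfSingularities.Theorems.CampaignW46.MohWindowShadeRunFormula

open Literature.AlgebraicGeometry.Resolution
open Literature.AlgebraicGeometry.Resolution.PointBlowup
open Literature.AlgebraicGeometry.Resolution.Hauser2010
open Literature.Barriers.ResolutionOfSingularities (ordZero_le_of_coeff_ne_zero le_ordZero_of_forall)
open MohWindowShadeCleaning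

variable {σ : Type*} {K : Type*} [Field K] [Fintype σ] [DecidableEq σ] [DecidableEq K]
variable (p : ℕ) [hp : Fact p.Prime] [CharP K p]

section TwoLetters

variable {j i : σ}

/-! ## §3. The run formula: `k` consecutive steps in the chart `y_j` -/

/-- **[OURS · L1 W4.6] THE RUN FORMULA (with remainder).**  Let `s₀, s₁, …` be states with
`s_{n+1} = step p j (b n) (s n)` — all steps in the SAME chart `y_j`, at the points `t_n = b n i` of the
`y_i`-axis (`b n j = 0`) — every residual polynomial having all its monomials of degree `≥ p`.  Then for every
`k` there are a polynomial `ψ = ψ_k(y_j)` in the letter `y_j` alone without constant term (the digit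
expansion `Σ_{n<k} t_n y_j^{n+1}`) and a `p`-th-power-supported `D` with
`F_k · y_j^{pk} + D = F₀(y_j, y_j^k·y_i + ψ(y_j))`: the `k`-fold blow-up along the points is the substitution
of the digit expansion.  NOT a statement of the manuscript. [folklore] -/
theorem exists_run_formula (hij : i ≠ j) (htwo : ∀ l, l = j ∨ l = i) (s : ℕ → State σ K) (b : ℕ → σ → K)
    (hb : ∀ n, b n j = 0) (hstep : ∀ n, s (n + 1) = step p j (b n) (s n))
    (hdeg : ∀ n, ∀ d ∈ (s n).F.support, p ≤ d.degree) (k : ℕ) :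
    ∃ ψ D : MvPolynomial σ K, (∀ f : σ → MvPolynomial σ K, f j = X j → aeval f ψ = ψ) ∧
      coeff 0 ψ = 0 ∧ coeff (Finsupp.single i 1) ψ = 0 ∧ (∀ d ∈ D.support, IsPthPowerExponent p d) ∧
      (s k).F * X j ^ (p * k) + D = aeval (fun l => if l = j then X j else X j ^ k * X l + ψ) (s 0).F := by
  induction k with
  | zero =>
    refine ⟨0, 0, fun f _ => by simp, by simp, by simp, fun d hd => by simp at hd, ?_⟩
    have hid : (fun l => if l = j then X j else X j ^ 0 * X l + (0 : MvPolynomial σ K)) = X := by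
      funext l
      split_ifs with h
      · rw [h]
      · rw [pow_zero, one_mul, add_zero]
    rw [hid, aeval_X_left_apply, mul_zero, pow_zero, mul_one, add_zero]
  | succ k ih =>
    obtain ⟨ψ, D, hψf, hψ0, hψ1, hD, hrun⟩ := ih
    obtain ⟨D₁, hD₁, hone⟩ := exists_step_mul_X_pow_add p hij htwo (b k) (hb k) (s k) (hdeg k)
    set fb : σ → MvPolynomial σ K := fun l => if l = j then X j else (X l + C (b k l)) * X j with hfb
    have hfbj : fb j = X j := by rw [hfb]; exact if_pos rfl
    have hfbi : fb i = (X i + C (b k i)) * X j := by rw [hfb]; exact if_neg hij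
    refine ⟨ψ + C (b k i) * X j ^ (k + 1), aeval fb D + D₁ * X j ^ (p * k), ?_, ?_, ?_, ?_, ?_⟩
    · intro f hf
      rw [map_add, hψf f hf, map_mul, map_pow, aeval_X, hf, aeval_C, MvPolynomial.algebraMap_eq]
    · rw [coeff_add, hψ0, coeff_C_mul, coeff_X_pow, if_neg, mul_zero, add_zero]
      intro h
      have := congrArg (fun e => e j) h
      simp at this
    · rw [coeff_add, hψ1, coeff_C_mul, coeff_X_pow, if_neg, mul_zero, add_zero]
      intro h
      have := congrArg (fun e => e i) h
      simp [hij] at this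
    · exact forall_support_add p (forall_support_aeval p fb hD)
        (forall_support_mul p hD₁ (forall_support_pow_mul p (X j) k))
    · -- the composite substitution
      have hcomp : (fun l => aeval fb ((fun l => if l = j then X j else X j ^ k * X l + ψ) l))
          = fun l => if l = j then X j else X j ^ (k + 1) * X l + (ψ + C (b k i) * X j ^ (k + 1)) := by
        funext l
        by_cases hl : l = j
        · simp only [hl, if_true]
          rw [aeval_X, hfbj]
        · have hli : l = i := by rcases htwo l with h | h; exacts [absurd h hl, h]
          simp only [hl, if_false]
          rw [map_add, map_mul, map_pow, aeval_X, aeval_X, hfbj, hψf fb hfbj, hli, hfbi]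
          ring
      rw [hstep k, ← hcomp, ← comp_aeval_apply, ← hrun, map_add, map_mul, map_pow, aeval_X, hfbj,
        ← hone, mul_add p k 1, mul_one, pow_add]
      ring

/-! ## §4. Reading the support of the digit expansion -/

omit [Fintype σ] [DecidableEq K] hp [CharP K p] in
/-- The run substitution factors: `F(y_j, y_j^k y_i + ψ) = [F(y_j, y_i + ψ)](y_j, y_j^k y_i)` for `ψ` a
polynomial in `y_j` alone. [folklore] -/
theorem aeval_run_eq {ψ : MvPolynomial σ K}
    (hψf : ∀ f : σ → MvPolynomial σ K, f j = X j → aeval f ψ = ψ) (k : ℕ) (F : MvPolynomial σ K) :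
    aeval (fun l => if l = j then X j else X j ^ k * X l + ψ) F =
      aeval (fun l => if l = j then X j else X j ^ k * X l)
        (aeval (fun l => if l = j then X j else X l + ψ) F) := by
  have hfg : (fun l => if l = j then X j else X j ^ k * X l + ψ) = fun l =>
      aeval (fun l => if l = j then X j else X j ^ k * X l)
        ((fun l => if l = j then X j else X l + ψ) l) := by
    funext l
    by_cases hl : l = j
    · simp only [hl, if_true]
      rw [aeval_X, if_pos rfl]
    · simp only [hl, if_false]
      rw [map_add, aeval_X, if_neg hl, hψf _ (if_pos rfl)]
  rw [hfg, ← comp_aeval_apply]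

omit [Fintype σ] [DecidableEq K] hp [CharP K p] in
/-- The monomial substitution `y_i ↦ y_j^k y_i` acts on exponents by `e ↦ e + k e_i · e_j`. [folklore] -/
theorem aeval_monomialSubst_eq_sum (hij : i ≠ j) (htwo : ∀ l, l = j ∨ l = i) (k : ℕ)
    (Q : MvPolynomial σ K) :
    aeval (fun l => if l = j then X j else X j ^ k * X l) Q =
      ∑ e ∈ Q.support, monomial (e + Finsupp.single j (k * e i)) (coeff e Q) := by
  rw [aeval_eq_sum_support]
  refine Finset.sum_congr rfl fun e _ => ?_
  rw [aeval_monomial_two hij htwo, if_pos rfl, if_neg hij,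
    monomial_eq_C_mul hij htwo (e + Finsupp.single j (k * e i))]
  simp only [Finsupp.add_apply, Finsupp.single_apply, if_true, if_neg hij.symm, add_zero]
  rw [mul_pow, ← pow_mul, pow_add]
  ring

omit [Fintype σ] [DecidableEq σ] [DecidableEq K] hp [CharP K p] in
/-- The exponent map `e ↦ e + k e_i · e_j` is injective (two letters). [folklore] -/
theorem eq_of_add_single_eq (hij : i ≠ j) (htwo : ∀ l, l = j ∨ l = i) (k : ℕ) {e e' : σ →₀ ℕ}
    (h : e + Finsupp.single j (k * e i) = e' + Finsupp.single j (k * e' i)) : e = e' := by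
  have hi : e i = e' i := by
    have := DFunLike.congr_fun h i
    rwa [Finsupp.add_apply, Finsupp.add_apply, Finsupp.single_eq_of_ne hij,
      Finsupp.single_eq_of_ne hij, add_zero, add_zero] at this
  have hj : e j = e' j := by
    have := DFunLike.congr_fun h j
    rw [Finsupp.add_apply, Finsupp.add_apply, Finsupp.single_eq_same, Finsupp.single_eq_same,
      hi] at this
    omega
  rw [eq_single_add_single hij htwo e, eq_single_add_single hij htwo e', hi, hj]

/-- **[OURS · L1 W4.6] THE RUN FORMULA, cleaned, and its support.**  Let `s₀, …, s_k, …` be consecutive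
steps in the chart `y_j` as in `exists_run_formula`, starting from a CLEANED residual polynomial.  If every
monomial of `F_k` has degree `≥ o`, then for the digit expansion `ψ = ψ_k` every monomial `y^e` of the cleaned
expansion `clean(F₀(y_j, y_i + ψ(y_j)))` satisfies `o + pk ≤ e_j + (k+1)·e_i` — it lies on or above the
line through `(e_i, e_j) = (p, o − p)` of slope `−(k+1)`: the Newton polygon of `F₀` in the coordinates
`(y_i − ψ, y_j)`, read modulo `p`-th powers, is that of `y_i^p·(…)` up to height `k + 1`.
(Mechanism: `F_k · y_j^{pk} = clean(F₀(y_j, y_j^k y_i + ψ)) = [clean(F₀(y_j, y_i + ψ))](y_j, y_j^k y_i)`,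
the monomial substitution being injective on exponents and class-preserving.)  NOT a statement of the
manuscript. [folklore] -/
theorem exists_digits_support_bound (hij : i ≠ j) (htwo : ∀ l, l = j ∨ l = i) (s : ℕ → State σ K)
    (b : ℕ → σ → K) (hb : ∀ n, b n j = 0) (hstep : ∀ n, s (n + 1) = step p j (b n) (s n))
    (hclean : deletePthPowers p (s 0).F = (s 0).F) (hdeg : ∀ n, ∀ d ∈ (s n).F.support, p ≤ d.degree)
    (k : ℕ) {o : ℕ} (ho : ∀ d ∈ (s k).F.support, o ≤ d.degree) :
    ∃ ψ : MvPolynomial σ K, (∀ f : σ → MvPolynomial σ K, f j = X j → aeval f ψ = ψ) ∧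
      coeff 0 ψ = 0 ∧ coeff (Finsupp.single i 1) ψ = 0 ∧
      ∀ e ∈ (deletePthPowers p (aeval (fun l => if l = j then X j else X l + ψ) (s 0).F)).support,
        o + p * k ≤ e j + (k + 1) * e i := by
  classical
  obtain ⟨ψ, D, hψf, hψ0, hψ1, hD, hrun⟩ := exists_run_formula p hij htwo s b hb hstep hdeg k
  refine ⟨ψ, hψf, hψ0, hψ1, ?_⟩
  -- the cleaned residual polynomials
  have hcleank : deletePthPowers p (s k).F = (s k).F := by
    rcases k with _ | k
    · exact hclean
    · rw [hstep k]; exact deletePthPowers_step p j (b k) (s k)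
  set τ : σ → MvPolynomial σ K := fun l => if l = j then X j else X l + ψ with hτ
  set Hk : σ → MvPolynomial σ K := fun l => if l = j then X j else X j ^ k * X l with hHk
  set Q := deletePthPowers p (aeval τ (s 0).F) with hQ
  -- `F_k y_j^{pk} = (clean ∘ aeval Hk)(aeval τ F₀) = aeval Hk Q`
  have hQclean : ∀ d ∈ (aeval Hk Q).support, ¬ IsPthPowerExponent p d := by
    intro d hd hPd
    rw [hHk, aeval_monomialSubst_eq_sum hij htwo k Q] at hd
    obtain ⟨e, he, -, rfl⟩ := exists_of_mem_support_sum_monomial _ _ _ hd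
    have hQe : ¬ IsPthPowerExponent p e :=
      not_isPthPowerExponent_of_clean p (deletePthPowers_deletePthPowers p _) he
    apply hQe
    rw [isPthPowerExponent_iff] at hPd ⊢
    have hi' := hPd i
    have hj' := hPd j
    simp only [Finsupp.add_apply, Finsupp.single_apply, if_true, if_neg hij.symm, add_zero] at hi' hj'
    intro l
    rcases htwo l with rfl | rfl
    · exact (Nat.dvd_add_left (Dvd.dvd.mul_left hi' k)).mp hj'
    · exact hi'
  have hFk : (s k).F * X j ^ (p * k) = aeval Hk Q := by
    have h1 : aeval τ (s 0).F = Q + (aeval τ (s 0).F - Q) := by ring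
    have hC₁ := forall_support_sub_deletePthPowers p (aeval τ (s 0).F)
    rw [aeval_run_eq hψf k, ← hHk, ← hτ, h1, map_add] at hrun
    have h2 := congrArg (deletePthPowers p) hrun
    rw [deletePthPowers_add_of_forall p _ hD, deletePthPowers_mul_X_pow, hcleank,
      deletePthPowers_add_of_forall p _ (forall_support_aeval p Hk hC₁),
      deletePthPowers_eq_self_of_forall p hQclean] at h2
    exact h2
  -- read the support
  intro e he
  have hcoeff : coeff (e + Finsupp.single j (k * e i)) (aeval Hk Q) = coeff e Q := by
    rw [hHk, aeval_monomialSubst_eq_sum hij htwo k Q]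
    exact coeff_sum_monomial_of_injOn Q.support _ _ he
      (fun e' _ _ h => eq_of_add_single_eq hij htwo k h)
  have hmem : coeff (e + Finsupp.single j (k * e i)) ((s k).F * X j ^ (p * k)) ≠ 0 := by
    rw [hFk, hcoeff]; exact MvPolynomial.mem_support_iff.mp he
  rw [X_pow_eq_monomial, coeff_mul_monomial'] at hmem
  split_ifs at hmem with hle
  · rw [mul_one] at hmem
    have hd := ho _ (MvPolynomial.mem_support_iff.mpr hmem)
    have h3 : (e + Finsupp.single j (k * e i) - Finsupp.single j (p * k)).degree
        + (Finsupp.single j (p * k)).degree = (e + Finsupp.single j (k * e i)).degree := by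
      rw [← map_add, tsub_add_cancel_of_le hle]
    rw [map_add, Finsupp.degree_single, Finsupp.degree_single, degree_eq_add hij htwo e] at h3
    have h4 : (k + 1) * e i = k * e i + e i := by ring
    omega
  · exact absurd rfl hmem

/-! ## §5. From the support bound to the formal `p`-fold curve -/

omit [Fintype σ] [DecidableEq σ] [DecidableEq K] hp [CharP K p] in
/-- Degrees of the monomials of a product are at least the sum of the least degrees. [folklore] -/
theorem le_degree_of_mem_support_mul {A B : MvPolynomial σ K} {a c : ℕ}
    (hA : ∀ d ∈ A.support, a ≤ d.degree) (hB : ∀ d ∈ B.support, c ≤ d.degree) :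
    ∀ d ∈ (A * B).support, a + c ≤ d.degree := by
  classical
  intro d hd
  obtain ⟨x, hx, y, hy, rfl⟩ := Finset.mem_add.mp (support_mul A B hd)
  rw [map_add]
  exact add_le_add (hA x hx) (hB y hy)

omit [Fintype σ] [DecidableEq σ] [DecidableEq K] hp [CharP K p] in
/-- Degrees of the monomials of a power of a polynomial without constant term. [folklore] -/
theorem le_degree_of_mem_support_pow {A : MvPolynomial σ K} (hA : ∀ d ∈ A.support, 1 ≤ d.degree)
    (n : ℕ) : ∀ d ∈ (A ^ n).support, n ≤ d.degree := by
  classical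
  induction n with
  | zero => intro d _; exact Nat.zero_le _
  | succ n ih =>
    rw [pow_succ]
    exact le_degree_of_mem_support_mul ih hA

omit [DecidableEq σ] [DecidableEq K] hp [CharP K p] in
/-- A substitution by polynomials without constant terms does not lower the order. [folklore] -/
theorem le_degree_of_mem_support_aeval (hij : i ≠ j) (htwo : ∀ l, l = j ∨ l = i)
    (f : σ → MvPolynomial σ K) (hf : ∀ l, ∀ d ∈ (f l).support, 1 ≤ d.degree) {P : MvPolynomial σ K}
    {m : ℕ} (hP : ∀ e ∈ P.support, m ≤ e.degree) : ∀ d ∈ (aeval f P).support, m ≤ d.degree := by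
  classical
  intro d hd
  rw [aeval_eq_sum_support] at hd
  obtain ⟨e, he, hde⟩ := Finset.mem_biUnion.mp (support_sum hd)
  rw [aeval_monomial_two hij htwo] at hde
  have h1 : ∀ d ∈ (C (coeff e P) * f j ^ e j * f i ^ e i).support, 0 + e j + e i ≤ d.degree :=
    le_degree_of_mem_support_mul
      (le_degree_of_mem_support_mul (fun _ _ => Nat.zero_le _) (le_degree_of_mem_support_pow (hf j) _))
      (le_degree_of_mem_support_pow (hf i) _)
  have h2 := h1 d hde
  have h3 := hP e he
  rw [degree_eq_add hij htwo e] at h3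
  omega

omit [Fintype σ] [DecidableEq σ] [DecidableEq K] hp [CharP K p] in
/-- Monomials of a polynomial without constant term have positive degree. [folklore] -/
theorem one_le_degree_of_coeff_zero {P : MvPolynomial σ K} (h0 : coeff 0 P = 0) :
    ∀ d ∈ P.support, 1 ≤ d.degree := by
  intro d hd
  by_contra hlt
  have hd0 : d = 0 := (Finsupp.degree_eq_zero_iff d).mp (by omega)
  rw [hd0] at hd
  exact (MvPolynomial.mem_support_iff.mp hd) h0

omit [DecidableEq K] in
/-- **[OURS · L1 W4.6] FROM THE SUPPORT BOUND TO THE FORMAL `p`-FOLD CURVE.**  Let `F` be cleaned and `ψ`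
a polynomial in `y_j` alone without constant term.  If every monomial `y^e` of `clean(F(y_j, y_i + ψ(y_j)))`
satisfies `o + pk ≤ e_j + (k+1)·e_i`, then `F ≡ (y_i − ψ(y_j))^p · w` modulo monomials of degree `≥ o + k`
for an explicit cofactor `w`: the residual polynomial is, to order `o + k`, the `p`-th power of the SMOOTH
curve `y_i = ψ(y_j)` times a cofactor.  (Split the cleaned expansion into its part divisible by `y_i^p` and a
part of order `≥ o + k`, substitute back `y_i ↦ y_i − ψ`, and re-clean: the cleaning commutes with the
`p`-th-power-supported factor `(y_i − ψ)^p`.)  NOT a statement of the manuscript. [folklore] -/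
theorem exists_cofactor_of_support_bound (hij : i ≠ j) (htwo : ∀ l, l = j ∨ l = i) {F : MvPolynomial σ K}
    (hF : deletePthPowers p F = F) {ψ : MvPolynomial σ K}
    (hψf : ∀ f : σ → MvPolynomial σ K, f j = X j → aeval f ψ = ψ) (hψ0 : coeff 0 ψ = 0) {o k : ℕ}
    (hQ : ∀ e ∈ (deletePthPowers p (aeval (fun l => if l = j then X j else X l + ψ) F)).support,
      o + p * k ≤ e j + (k + 1) * e i) :
    ∃ w : MvPolynomial σ K, ((o + k : ℕ) : ℕ∞) ≤ ordZero (F - (X i - ψ) ^ p * w) := by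
  classical
  set τ : σ → MvPolynomial σ K := fun l => if l = j then X j else X l + ψ with hτ
  set τ' : σ → MvPolynomial σ K := fun l => if l = j then X j else X l - ψ with hτ'
  set Q := deletePthPowers p (aeval τ F) with hQdef
  -- split `Q = y_i^p · W + Q₂`
  set W : MvPolynomial σ K :=
    ∑ e ∈ Q.support with p ≤ e i, monomial (e - Finsupp.single i p) (coeff e Q) with hW
  set Q₂ : MvPolynomial σ K := ∑ e ∈ Q.support with ¬ p ≤ e i, monomial e (coeff e Q) with hQ₂
  have hsplit : Q = X i ^ p * W + Q₂ := by
    rw [hW, hQ₂, Finset.mul_sum]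
    have h1 : ∀ e ∈ Q.support.filter (fun e => p ≤ e i),
        X i ^ p * monomial (e - Finsupp.single i p) (coeff e Q) = monomial e (coeff e Q) := by
      intro e he
      have hle : Finsupp.single i p ≤ e := Finsupp.single_le_iff.mpr (Finset.mem_filter.mp he).2
      rw [← monomial_single_add, add_tsub_cancel_of_le hle]
    rw [Finset.sum_congr rfl h1, Finset.sum_filter_add_sum_filter_not]
    exact Q.as_sum
  -- `Q₂` has order `≥ o + k`
  have hQ₂deg : ∀ e ∈ Q₂.support, o + k ≤ e.degree := by
    intro e he
    rw [hQ₂] at he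
    obtain ⟨e', he', -, rfl⟩ := exists_of_mem_support_sum_monomial _ _ _ he
    obtain ⟨he'Q, hlt⟩ := Finset.mem_filter.mp he'
    have h1 := hQ e' he'Q
    have h2 : k * e' i + k ≤ p * k := by
      have := Nat.mul_le_mul_left k (show e' i + 1 ≤ p by omega)
      rw [mul_add, mul_one, mul_comm k p] at this
      exact this
    rw [degree_eq_add hij htwo e']
    have h3 : (k + 1) * e' i = k * e' i + e' i := by ring
    omega
  -- undo the substitution
  have hback : aeval τ' (aeval τ F) = F := by
    rw [comp_aeval_apply]
    have hX : (fun l => aeval τ' (τ l)) = X := by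
      funext l
      by_cases hl : l = j
      · rw [hτ]; simp only [hl, if_true]; rw [aeval_X, hτ']; exact if_pos rfl
      · rw [hτ]; simp only [hl, if_false]
        rw [map_add, aeval_X, hψf τ' (by rw [hτ']; exact if_pos rfl), hτ']
        simp only [hl, if_false]; ring
    rw [hX, aeval_X_left_apply]
  have hC₁ := forall_support_sub_deletePthPowers p (aeval τ F)
  have hFeq : F = (X i - ψ) ^ p * aeval τ' W + aeval τ' Q₂ + aeval τ' (aeval τ F - Q) := by
    have h1 : aeval τ F = X i ^ p * W + Q₂ + (aeval τ F - Q) := by rw [← hsplit]; ring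
    have h2 := congrArg (aeval τ') h1
    rw [hback, map_add, map_add, map_mul, map_pow, aeval_X] at h2
    have hτ'i : τ' i = X i - ψ := by rw [hτ']; exact if_neg hij
    rw [hτ'i] at h2
    exact h2
  refine ⟨deletePthPowers p (aeval τ' W), ?_⟩
  -- re-clean
  have hF2 : F - (X i - ψ) ^ p * deletePthPowers p (aeval τ' W) = deletePthPowers p (aeval τ' Q₂) := by
    have h1 := congrArg (deletePthPowers p) hFeq
    rw [hF, deletePthPowers_add_of_forall p _ (forall_support_aeval p τ' hC₁), deletePthPowers_add,
      deletePthPowers_mul_of_forall p (forall_support_pow_char p _)] at h1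
    rw [h1]; ring
  rw [hF2]
  refine le_ordZero_of_forall _ _ fun d hd => ?_
  have hd' := support_deletePthPowers_subset p _ (MvPolynomial.mem_support_iff.mpr hd)
  refine le_degree_of_mem_support_aeval hij htwo τ' ?_ hQ₂deg d hd'
  intro l
  by_cases hl : l = j
  · rw [hτ']; simp only [hl, if_true]
    intro d hd
    rw [support_X, Finset.mem_singleton] at hd
    rw [hd, Finsupp.degree_single]
  · rw [hτ']; simp only [hl, if_false]
    refine one_le_degree_of_coeff_zero ?_
    rw [coeff_sub, coeff_X, if_neg (Finsupp.single_ne_zero.mpr one_ne_zero), hψ0, sub_zero]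

/-- **[OURS · L1 W4.6] A LONG PHASE OF POINT BLOW-UPS IN ONE CHART MAKES THE RESIDUAL POLYNOMIAL A FORMAL
`p`-TH POWER OF A SMOOTH CURVE.**  Let `s₀, s₁, …` be consecutive point blow-ups of `x^p + F(y_j, y_i)` all
read in the chart `y_j` (at the points `b n` with `b n j = 0` — the translational and horizontal moves of
Hauser–Wagner's frame), starting from a cleaned residual polynomial, every residual polynomial having all
its monomials of degree `≥ p`.  If the `k`-th residual polynomial still has all its monomials of degree
`≥ o`, then `F₀ ≡ h^p · w` modulo monomials of degree `≥ o + k` for a polynomial `h = y_i − ψ_k(y_j)`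
defining a SMOOTH curve through the origin (`h(0) = 0`, `∂h/∂y_i(0) = 1`) — `ψ_k` the digit expansion of the
points of the phase — and a cofactor `w`.  Applied with `o = ord F_n` constant along an infinite stall
phase of shade `p`, this puts the start of the phase in the formal `p`-fold-curve case to every order.
Replaces, for the classical pair in regime (iii), surfaces, the ROLE of the termination clause of
Th. 16.13 (ms. p. 87); NOT a statement of the manuscript. [folklore] -/
theorem exists_formal_pth_power_of_run (hij : i ≠ j) (htwo : ∀ l, l = j ∨ l = i) (s : ℕ → State σ K)
    (b : ℕ → σ → K) (hb : ∀ n, b n j = 0) (hstep : ∀ n, s (n + 1) = step p j (b n) (s n))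
    (hclean : deletePthPowers p (s 0).F = (s 0).F) (hdeg : ∀ n, ∀ d ∈ (s n).F.support, p ≤ d.degree)
    (k : ℕ) {o : ℕ} (ho : ∀ d ∈ (s k).F.support, o ≤ d.degree) :
    ∃ h w : MvPolynomial σ K, coeff 0 h = 0 ∧ coeff (Finsupp.single i 1) h = 1 ∧
      ((o + k : ℕ) : ℕ∞) ≤ ordZero ((s 0).F - h ^ p * w) := by
  obtain ⟨ψ, hψf, hψ0, hψ1, hQ⟩ :=
    exists_digits_support_bound p hij htwo s b hb hstep hclean hdeg k ho
  obtain ⟨w, hw⟩ := exists_cofactor_of_support_bound p hij htwo hclean hψf hψ0 hQ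
  refine ⟨X i - ψ, w, ?_, ?_, hw⟩
  · rw [coeff_sub, coeff_X, if_neg (Finsupp.single_ne_zero.mpr one_ne_zero), hψ0, sub_zero]
  · rw [coeff_sub, coeff_X, if_pos rfl, hψ1, sub_zero]

end TwoLetters

end Summit.ResolutionOfSingularities.ResolutionOfSingularities.Theorems.CampaignW46.MohWindowShadeRunFormula
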